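import Mathlib
import Literature.Combinatorics.Additive.TripleProductProperty
import Literature.Barriers.MatrixMultiplication.NormalizerBarrier
import Literature.RepresentationTheory.FiniteGroups.WedderburnBlocks
import Literature.RepresentationTheory.FiniteGroups.VershikKerovLimitShape
import Summits.MatrixMultiplication.MatrixMultiplication.Theses.SnSubsetDichotomy

/-!
# `HyperoctahedralThreshold` (crux stmt-MatrixMultiplication-10883, route SnSubsetDichotomy):
# the subgroup-pivot sieve — no design may concede a whole subgroup

Negative-side support file (refuter, crux-triage r1-1); `sorry`-free.

* `sieve` — **subgroup-pivot sieve**: `G` finite, `H ≤ G` with underlying finset `S`, `X₁, X₂ ⊆ G`,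
  `TripleProductProperty S X₁ X₂` (tree convention) ⇒ `|H|·|X₁|·|X₂| ≤ |G|·d_max(G)`.
  Proof: the `|X₁||X₂|` coset indicators `δ_{t⁻¹} * 1_H * δ_{u'}` are linearly independent in `ℂ[G]`
  (by the TPP their values at the points `t'⁻¹u` form an identity matrix) and lie in the two-sided
  ideal of `1_H`; through a Wedderburn decomposition `φ : ℂ[G] ≃ₐ ∏ᵢ ℂ^{dᵢ×dᵢ}`
  (`WedderburnBlocks.exists_algEquiv_pi_matrix`) that ideal sits in the blocks where `φ 1_H ≠ 0`, of
  dimension `Σ dᵢ² ≤ d_max·Σ dᵢ`, and this `Σ dᵢ` is at most the rank of `x ↦ x * 1_H`, i.e. `≤ [G:H]`.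
* `subgroup_sieve` — three subgroups: `|H₀|·|H₁|·|H₂| ≤ |G|·d_max(G)`.
* `conceded_subgroup_cap` — in `S_n` with the tree's Vershik–Kerov theorem: a TPP triple of subsets
  whose first set is a subgroup has `|S||X₁||X₂| ≤ (n!)^{3/2}e^{-(c₂/2)√n}` for `n ≥ n₀`
  (`c₂ = vkUpperConst`); so no witness family for `HyperoctahedralThreshold` (`> (n!)^{3/2}e^{-c√n}`
  for EVERY `c`) keeps a whole rooted/full host or any whole subgroup as one of its sets — the round-1
  transfers `OneThinnedHostDesign`, `PivotThreshold`, defect-deletion `C⁺` are false as `∀c` claims.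

Published subgroup-capacity bounds are packing-type (P. M. Neumann, LMS J. Comput. Math. 14 (2011);
I. Hedtke, arXiv:1107.5969); Blasiak–Church–Cohn–Grochow–Umans (arXiv:1712.02302 §4) pose ruling out all
subgroup triples of `S_n` as open. Wedderburn set-up: Cohn–Umans 2003 §1.3.
-/

namespace Summit.MatrixMultiplication.MatrixMultiplication.Theorems.HyperoctahedralThreshold.Negative

open Literature.Combinatorics.Additive Literature.Barriers.MatrixMultiplication
  Literature.RepresentationTheory.FiniteGroups
open MonoidAlgebra

variable {G : Type} [Group G] [DecidableEq G]

omit [Group G] in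
/-- Coefficients of the indicator: `1_S(g) = [g ∈ S]`. -/
theorem ind_coeff (S : Finset G) (g : G) :
    (∑ h ∈ S, single h (1 : ℂ) : MonoidAlgebra ℂ G).coeff g = if g ∈ S then 1 else 0 := by
  rw [coeff_sum, Finsupp.finsetSum_apply]
  simp only [coeff_single, Finsupp.single_apply]
  rw [Finset.sum_ite_eq' S g (fun _ => (1 : ℂ))]

/-- Coefficients of the coset indicator `δ_a * 1_S * δ_b = 1_{aSb}`. -/
theorem sandwich_coeff (S : Finset G) (a b g : G) :
    (single a (1 : ℂ) * (∑ h ∈ S, single h (1 : ℂ)) * single b 1).coeff g = if a⁻¹ * g * b⁻¹ ∈ S then 1 else 0 := by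
  rw [mul_assoc, coeff_single_mul_apply, coeff_mul_single_apply, ind_coeff, one_mul, mul_one]

omit [DecidableEq G] in
/-- TPP with first set a subgroup: `t (t'⁻¹ u) u'⁻¹ ∈ H ⇔ t = t' ∧ u = u'`. -/
theorem tpp_pair_iff (H : Subgroup G) (S X₁ X₂ : Finset G) (hS : ∀ x, x ∈ S ↔ x ∈ H)
    (hT : TripleProductProperty S X₁ X₂) {t t' u u' : G} (ht : t ∈ X₁) (ht' : t' ∈ X₁)
    (hu : u ∈ X₂) (hu' : u' ∈ X₂) :
    t * (t'⁻¹ * u) * u'⁻¹ ∈ S ↔ (t = t' ∧ u = u') := by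
  constructor
  · intro hmem
    have hH : t * (t'⁻¹ * u) * u'⁻¹ ∈ H := (hS _).1 hmem
    have hinv : (t * (t'⁻¹ * u) * u'⁻¹)⁻¹ ∈ S := (hS _).2 (H.inv_mem hH)
    have h1 : (1 : G) ∈ S := (hS _).2 H.one_mem
    have key := hT _ hinv 1 h1 t ht t' ht' u hu u' hu' (by group)
    exact ⟨key.2.1, key.2.2⟩
  · rintro ⟨rfl, rfl⟩
    have : t * (t⁻¹ * u) * u⁻¹ = 1 := by group
    rw [this]
    exact (hS _).2 H.one_mem

/-- Evaluation identity: `v_c (t'⁻¹ u) = [c = (u, t')]`. -/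
theorem vec_coeff_point (H : Subgroup G) (S X₁ X₂ : Finset G) (hS : ∀ x, x ∈ S ↔ x ∈ H)
    (hT : TripleProductProperty S X₁ X₂) (c r : (X₂ ×ˢ X₁ : Finset (G × G))) :
    (single (c.1.2)⁻¹ (1 : ℂ) * (∑ h ∈ S, single h (1 : ℂ)) * single c.1.1 1).coeff ((r.1.2)⁻¹ * r.1.1) =
      if c = r then 1 else 0 := by
  obtain ⟨⟨u', t⟩, hc⟩ := c
  obtain ⟨⟨u, t'⟩, hr⟩ := r
  rw [Finset.mem_product] at hc hr
  rw [sandwich_coeff, inv_inv]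
  simp only
  have hiff := tpp_pair_iff H S X₁ X₂ hS hT hc.2 hr.2 hr.1 hc.1
  by_cases h : t = t' ∧ u = u'
  · rw [if_pos (hiff.2 h), if_pos]
    obtain ⟨rfl, rfl⟩ := h
    rfl
  · rw [if_neg (fun hm => h (hiff.1 hm)), if_neg]
    intro heq
    apply h
    have := congrArg Subtype.val heq
    simp only [Prod.mk.injEq] at this
    exact ⟨this.2, this.1.symm⟩

/-- The coset indicators are linearly independent (they shatter the points `t'⁻¹ u`). -/
theorem linearIndependent_vec (H : Subgroup G) (S X₁ X₂ : Finset G) (hS : ∀ x, x ∈ S ↔ x ∈ H)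
    (hT : TripleProductProperty S X₁ X₂) :
    LinearIndependent ℂ (fun p : (X₂ ×ˢ X₁ : Finset (G × G)) =>
      single (p.1.2)⁻¹ (1 : ℂ) * (∑ h ∈ S, single h (1 : ℂ)) * single p.1.1 1) := by
  rw [linearIndependent_iff']
  intro s g hsum i hi
  have key := congrArg (fun f : MonoidAlgebra ℂ G => f.coeff ((i.1.2)⁻¹ * i.1.1)) hsum
  simp only [coeff_sum, coeff_smul, Finsupp.finsetSum_apply, Finsupp.smul_apply, smul_eq_mul,
    coeff_zero, Finsupp.coe_zero, Pi.zero_apply] at key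
  simp_rw [vec_coeff_point H S X₁ X₂ hS hT] at key
  simpa [Finset.sum_ite_eq', hi] using key

/-! ## The right ideal of `1_H`: `x ↦ x * 1_H` has rank at most `[G:H]` -/

/-- Left invariance of `1_H`: `δ_h * 1_S = 1_S` for `h ∈ H`. -/
theorem single_mul_ind (H : Subgroup G) (S : Finset G) (hS : ∀ x, x ∈ S ↔ x ∈ H) {h : G}
    (hh : h ∈ H) : single h (1 : ℂ) * (∑ h ∈ S, single h (1 : ℂ)) = (∑ h ∈ S, single h (1 : ℂ)) := by
  apply coeff_injective
  ext g
  rw [coeff_single_mul_apply, ind_coeff, ind_coeff, one_mul]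
  have : h⁻¹ * g ∈ S ↔ g ∈ S := by
    rw [hS, hS]
    exact ⟨fun hm => by simpa using H.mul_mem hh hm, fun hg => H.mul_mem (H.inv_mem hh) hg⟩
  simp only [this]

/-- `δ_g * 1_S` only depends on the coset `gH`. -/
theorem single_out_mul_ind (H : Subgroup G) (S : Finset G) (hS : ∀ x, x ∈ S ↔ x ∈ H) (g : G) :
    single ((QuotientGroup.mk g : G ⧸ H).out) (1 : ℂ) * (∑ h ∈ S, single h (1 : ℂ)) = single g 1 * (∑ h ∈ S, single h (1 : ℂ)) := by
  obtain ⟨h, hh⟩ := QuotientGroup.mk_out_eq_mul H g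
  rw [hh, show (single (g * (h : G)) (1 : ℂ) : MonoidAlgebra ℂ G) = single g 1 * single (h : G) 1 by
    rw [single_mul_single, mul_one], mul_assoc, single_mul_ind H S hS h.2]

/-- The range of `x ↦ x * 1_S` is spanned by the `[G:H]` coset indicators. -/
theorem range_mulRight_le_span [Fintype G] (H : Subgroup G) (S : Finset G)
    (hS : ∀ x, x ∈ S ↔ x ∈ H) :
    LinearMap.range (LinearMap.mulRight ℂ ((∑ h ∈ S, single h (1 : ℂ)))) ≤
      Submodule.span ℂ (Set.range fun q : G ⧸ H => single q.out (1 : ℂ) * (∑ h ∈ S, single h (1 : ℂ))) := by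
  rintro y ⟨x, rfl⟩
  rw [LinearMap.mulRight_apply]
  have hx : x = ∑ g, single g (x.coeff g) := by
    apply coeff_injective
    rw [coeff_sum]
    simp only [coeff_single]
    exact (Finsupp.univ_sum_single x.coeff).symm
  rw [hx, Finset.sum_mul]
  refine Submodule.sum_mem _ fun g _ => ?_
  have : single g (x.coeff g) * (∑ h ∈ S, single h (1 : ℂ)) = x.coeff g • (single g (1 : ℂ) * (∑ h ∈ S, single h (1 : ℂ))) := by
    rw [← smul_mul_assoc, smul_single, smul_eq_mul, mul_one]
  rw [this, ← single_out_mul_ind H S hS g]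
  exact Submodule.smul_mem _ _ (Submodule.subset_span ⟨QuotientGroup.mk g, rfl⟩)

/-- Hence `finrank (range (· * 1_S)) ≤ [G:H]`. -/
theorem finrank_range_mulRight_le [Fintype G] (H : Subgroup G) (S : Finset G)
    (hS : ∀ x, x ∈ S ↔ x ∈ H) :
    Module.finrank ℂ (LinearMap.range (LinearMap.mulRight ℂ ((∑ h ∈ S, single h (1 : ℂ))))) ≤ H.index := by
  haveI : Module.Finite ℂ (MonoidAlgebra ℂ G) := Module.Finite.of_basis (MonoidAlgebra.basis G ℂ)
  haveI : Fintype (G ⧸ H) := Fintype.ofFinite _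
  calc Module.finrank ℂ (LinearMap.range (LinearMap.mulRight ℂ ((∑ h ∈ S, single h (1 : ℂ)))))
      ≤ Module.finrank ℂ (Submodule.span ℂ (Set.range fun q : G ⧸ H => single q.out (1 : ℂ) * (∑ h ∈ S, single h (1 : ℂ)))) :=
        Submodule.finrank_mono (range_mulRight_le_span H S hS)
    _ ≤ Fintype.card (G ⧸ H) := finrank_range_le_card _
    _ = H.index := by rw [Subgroup.index_eq_card, Nat.card_eq_fintype_card]


/-! ## Wedderburn-block bookkeeping -/

section Blocks

variable {r : ℕ} {d : Fin r → ℕ}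

/-- `a * e * b` vanishes in every block where `e` does. -/
theorem sandwich_mem_suppSub (e a b : BlockAlgebraC d) :
    a * e * b ∈ (Submodule.pi {i | e i = 0} (fun _ => ⊥) : Submodule ℂ (BlockAlgebraC d)) := by
  refine Submodule.mem_pi.2 fun i hi => ?_
  simp only [Set.mem_setOf_eq] at hi
  simp [Pi.mul_apply, hi]

/-- The support subspace `{x : eᵢ = 0 ⇒ xᵢ = 0}` has `finrank ≤ Σ_{i : eᵢ ≠ 0} dᵢ²`
(restriction to the non-vanishing blocks is injective). -/
theorem finrank_suppSub_le (e : BlockAlgebraC d) :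
    Module.finrank ℂ (Submodule.pi {i | e i = 0} (fun _ => ⊥) : Submodule ℂ (BlockAlgebraC d)) ≤
      ∑ i : {i // e i ≠ 0}, d i.1 ^ 2 := by
  let P : (Submodule.pi {i | e i = 0} (fun _ => ⊥) : Submodule ℂ (BlockAlgebraC d)) →ₗ[ℂ] (Π i : {i // e i ≠ 0}, Matrix (Fin (d i.1)) (Fin (d i.1)) ℂ) :=
    { toFun := fun x i => x.1 i.1
      map_add' := by intro x y; rfl
      map_smul' := by intro c x; rfl }
  have hP : Function.Injective P := by
    intro x y hxy
    apply Subtype.ext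
    funext i
    by_cases hi : e i = 0
    · rw [(Submodule.mem_bot ℂ).1 (Submodule.mem_pi.1 x.2 i hi),
        (Submodule.mem_bot ℂ).1 (Submodule.mem_pi.1 y.2 i hi)]
    · exact congrFun hxy ⟨i, hi⟩
  calc Module.finrank ℂ (Submodule.pi {i | e i = 0} (fun _ => ⊥) : Submodule ℂ (BlockAlgebraC d))
      ≤ Module.finrank ℂ (Π i : {i // e i ≠ 0}, Matrix (Fin (d i.1)) (Fin (d i.1)) ℂ) :=
        LinearMap.finrank_le_finrank_of_injective hP
    _ = ∑ i : {i // e i ≠ 0}, d i.1 ^ 2 := by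
        rw [Module.finrank_pi_fintype]
        simp [Module.finrank_matrix, sq]

/-- In one full matrix block: if `M ≠ 0` then the right ideal `{x * M}` has dimension `≥ n`
(the `n` matrices `E_{j,a₀} * M`, `M a₀ b₀ ≠ 0`, are linearly independent). -/
theorem le_finrank_range_mulRight_matrix {n : ℕ} (M : Matrix (Fin n) (Fin n) ℂ) (hM : M ≠ 0) :
    n ≤ Module.finrank ℂ (LinearMap.range (LinearMap.mulRight ℂ M)) := by
  obtain ⟨a₀, b₀, hab⟩ : ∃ a b, M a b ≠ 0 := by
    by_contra h
    push Not at h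
    exact hM (Matrix.ext fun a b => h a b)
  let F : Fin n → LinearMap.range (LinearMap.mulRight ℂ M) :=
    fun j => ⟨Matrix.single j a₀ (1 : ℂ) * M, ⟨Matrix.single j a₀ 1, rfl⟩⟩
  have hF : LinearIndependent ℂ F := by
    apply LinearIndependent.of_comp (LinearMap.range (LinearMap.mulRight ℂ M)).subtype
    rw [linearIndependent_iff']
    intro s g hsum j hj
    have key := congrArg (fun X : Matrix (Fin n) (Fin n) ℂ => X j b₀) hsum
    simp only [Function.comp_apply, Submodule.coe_subtype, Matrix.sum_apply, Matrix.smul_apply,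
      smul_eq_mul, Matrix.zero_apply, F] at key
    rw [Finset.sum_eq_single j] at key
    · have h1 : (Matrix.single j a₀ (1 : ℂ) * M) j b₀ = M a₀ b₀ := by
        simp [Matrix.mul_apply, Matrix.single_apply]
      rw [h1] at key
      exact (mul_eq_zero.1 key).resolve_right hab
    · intro j' _ hne
      have h0 : (Matrix.single j' a₀ (1 : ℂ) * M) j b₀ = 0 := by
        simp [Matrix.mul_apply, hne]
      rw [h0, mul_zero]
    · intro hjs
      exact absurd hj hjs
  have := hF.fintype_card_le_finrank
  simpa using this

/-- Summing over the blocks: `Σ_{i : eᵢ ≠ 0} dᵢ ≤ finrank (range (· * e))`. -/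
theorem sum_le_finrank_range_mulRight (e : BlockAlgebraC d) :
    ∑ i : {i // e i ≠ 0}, d i.1 ≤ Module.finrank ℂ (LinearMap.range (LinearMap.mulRight ℂ e)) := by
  -- the product of the block right-ideals injects into the right ideal of `e`
  let R : {i // e i ≠ 0} → Type := fun i => LinearMap.range (LinearMap.mulRight ℂ (e i.1))
  let Q : (Π i : {i // e i ≠ 0}, R i) →ₗ[ℂ] LinearMap.range (LinearMap.mulRight ℂ e) :=
    { toFun := fun y => ⟨fun i => if h : e i ≠ 0 then ((y ⟨i, h⟩ : R ⟨i, h⟩) : Matrix _ _ ℂ) else 0, by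
        refine ⟨fun i => if h : e i ≠ 0 then Classical.choose (y ⟨i, h⟩).2 else 0, ?_⟩
        funext i
        simp only [LinearMap.mulRight_apply, Pi.mul_apply]
        by_cases h : e i ≠ 0
        · rw [dif_pos h, dif_pos h]
          exact Classical.choose_spec (y ⟨i, h⟩).2
        · rw [dif_neg h, dif_neg h, zero_mul]⟩
      map_add' := by
        intro x y
        apply Subtype.ext
        funext i
        simp only [Submodule.coe_add, Pi.add_apply]
        by_cases h : e i ≠ 0
        · simp [dif_pos h, R]
        · simp [dif_neg h]
      map_smul' := by
        intro c x
        apply Subtype.ext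
        funext i
        simp only [Submodule.coe_smul, Pi.smul_apply, RingHom.id_apply]
        by_cases h : e i ≠ 0
        · simp [dif_pos h, R]
        · simp [dif_neg h] }
  have hQ : Function.Injective Q := by
    intro x y hxy
    funext i
    have := congrFun (congrArg Subtype.val hxy) i.1
    simp only [Q, LinearMap.coe_mk, AddHom.coe_mk, dif_pos i.2] at this
    exact Subtype.ext this
  calc ∑ i : {i // e i ≠ 0}, d i.1
      ≤ ∑ i : {i // e i ≠ 0}, Module.finrank ℂ (R i) :=
        Finset.sum_le_sum fun i _ => le_finrank_range_mulRight_matrix (e i.1) i.2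
    _ = Module.finrank ℂ (Π i : {i // e i ≠ 0}, R i) := (Module.finrank_pi_fintype ℂ).symm
    _ ≤ Module.finrank ℂ (LinearMap.range (LinearMap.mulRight ℂ e)) :=
        LinearMap.finrank_le_finrank_of_injective hQ

end Blocks

/-! ## The sieve -/

/-- **Subgroup-pivot sieve.** For a finite group `G`, a subgroup `H` with underlying finset `S`,
and subsets `X₁, X₂` such that `(S, X₁, X₂)` has the triple product property,
`|H|·|X₁|·|X₂| ≤ |G|·d_max(G)`. -/
theorem sieve [Fintype G] (H : Subgroup G) (S X₁ X₂ : Finset G) (hS : ∀ x, x ∈ S ↔ x ∈ H)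
    (hT : TripleProductProperty S X₁ X₂) :
    Nat.card H * X₁.card * X₂.card ≤ Nat.card G * maxCharDegree G := by
  classical
  obtain ⟨r, d, hd, ⟨φ⟩⟩ := exists_algEquiv_pi_matrix G
  haveI : ∀ i, NeZero (d i) := hd
  set e : BlockAlgebraC d := φ ((∑ h ∈ S, single h (1 : ℂ))) with he
  -- Step 1: |X₂ × X₁| ≤ finrank of the support subspace of e
  have hli := linearIndependent_vec H S X₁ X₂ hS hT
  have hmem : ∀ p : (X₂ ×ˢ X₁ : Finset (G × G)),
      φ (single (p.1.2)⁻¹ (1 : ℂ) * (∑ h ∈ S, single h (1 : ℂ)) * single p.1.1 1) ∈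
        (Submodule.pi {i | e i = 0} (fun _ => ⊥) : Submodule ℂ (BlockAlgebraC d)) := by
    intro p
    rw [map_mul, map_mul]
    exact sandwich_mem_suppSub e _ _
  let w : (X₂ ×ˢ X₁ : Finset (G × G)) → (Submodule.pi {i | e i = 0} (fun _ => ⊥) : Submodule ℂ (BlockAlgebraC d)) :=
    fun p => ⟨φ (single (p.1.2)⁻¹ (1 : ℂ) * (∑ h ∈ S, single h (1 : ℂ)) * single p.1.1 1), hmem p⟩
  have hw : LinearIndependent ℂ w := by
    apply LinearIndependent.of_comp (Submodule.subtype _)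
    have hcomp : Submodule.subtype _ ∘ w = φ.toLinearEquiv.toLinearMap ∘
        (fun p : (X₂ ×ˢ X₁ : Finset (G × G)) => single (p.1.2)⁻¹ (1 : ℂ) * (∑ h ∈ S, single h (1 : ℂ)) * single p.1.1 1) := by
      funext p; rfl
    rw [hcomp]
    exact hli.map' _ φ.toLinearEquiv.ker
  have h1 : Fintype.card (X₂ ×ˢ X₁ : Finset (G × G)) ≤ Module.finrank ℂ (Submodule.pi {i | e i = 0} (fun _ => ⊥) : Submodule ℂ (BlockAlgebraC d)) :=
    hw.fintype_card_le_finrank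
  -- Step 2: that finrank ≤ Σ dᵢ² ≤ d_max · Σ dᵢ over the non-vanishing blocks
  have h2 := finrank_suppSub_le e
  have h3 : ∑ i : {i // e i ≠ 0}, d i.1 ^ 2 ≤ maxCharDegree G * ∑ i : {i // e i ≠ 0}, d i.1 := by
    rw [Finset.mul_sum]
    refine Finset.sum_le_sum fun i _ => ?_
    rw [sq]
    exact Nat.mul_le_mul_right _ (blockDegree_le_maxCharDegree φ i.1)
  -- Step 3: Σ dᵢ ≤ finrank range (· * e) = finrank range (· * 1_S) ≤ [G:H]
  have h4 := sum_le_finrank_range_mulRight e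
  have h5 : Module.finrank ℂ (LinearMap.range (LinearMap.mulRight ℂ e)) =
      Module.finrank ℂ (LinearMap.range (LinearMap.mulRight ℂ ((∑ h ∈ S, single h (1 : ℂ))))) := by
    have hmap : LinearMap.range (LinearMap.mulRight ℂ e) =
        (LinearMap.range (LinearMap.mulRight ℂ ((∑ h ∈ S, single h (1 : ℂ))))).map φ.toLinearEquiv.toLinearMap := by
      ext y
      simp only [LinearMap.mem_range, LinearMap.mulRight_apply, Submodule.mem_map]
      constructor
      · rintro ⟨x, rfl⟩
        refine ⟨φ.symm x * (∑ h ∈ S, single h (1 : ℂ)), ⟨φ.symm x, rfl⟩, ?_⟩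
        simp [he]
      · rintro ⟨z, ⟨x, rfl⟩, rfl⟩
        exact ⟨φ x, by simp [he]⟩
    rw [hmap, LinearEquiv.finrank_map_eq]
  have h6 := finrank_range_mulRight_le H S hS
  have hcard : Fintype.card (X₂ ×ˢ X₁ : Finset (G × G)) = X₂.card * X₁.card := by
    rw [Fintype.card_coe, Finset.card_product]
  have hmain : X₁.card * X₂.card ≤ maxCharDegree G * H.index :=
    calc X₁.card * X₂.card = Fintype.card (X₂ ×ˢ X₁ : Finset (G × G)) := by rw [hcard, mul_comm]
      _ ≤ Module.finrank ℂ (Submodule.pi {i | e i = 0} (fun _ => ⊥) : Submodule ℂ (BlockAlgebraC d)) := h1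
      _ ≤ ∑ i : {i // e i ≠ 0}, d i.1 ^ 2 := h2
      _ ≤ maxCharDegree G * ∑ i : {i // e i ≠ 0}, d i.1 := h3
      _ ≤ maxCharDegree G * H.index := Nat.mul_le_mul_left _ (h4.trans (h5 ▸ h6))
  calc Nat.card H * X₁.card * X₂.card = Nat.card H * (X₁.card * X₂.card) := by ring
    _ ≤ Nat.card H * (maxCharDegree G * H.index) := Nat.mul_le_mul_left _ hmain
    _ = Nat.card G * maxCharDegree G := by
        rw [mul_comm (maxCharDegree G), ← mul_assoc, Subgroup.card_mul_index]

/-! ## Corollaries -/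

/-- **Three subgroups.** A TPP triple of subgroups of a finite group satisfies
`|H₀|·|H₁|·|H₂| ≤ |G|·d_max(G)` (the sieve with `S = H₀` and the tree's
`subgroupTPP_iff_tripleProductProperty`). -/
theorem subgroup_sieve {G : Type} [Group G] [Fintype G] (H₀ H₁ H₂ : Subgroup G)
    (hT : SubgroupTPP H₀ H₁ H₂) :
    Nat.card H₀ * Nat.card H₁ * Nat.card H₂ ≤ Nat.card G * maxCharDegree G := by
  classical
  have hT' := (subgroupTPP_iff_tripleProductProperty H₀ H₁ H₂).1 hT
  have key := sieve H₀ (Finset.univ.filter (· ∈ H₀)) (Finset.univ.filter (· ∈ H₁))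
    (Finset.univ.filter (· ∈ H₂)) (fun x => by simp) hT'
  rwa [← (Nat.subtype_card (Finset.univ.filter (· ∈ H₁)) (fun x => by simp) : Nat.card H₁ = _),
    ← (Nat.subtype_card (Finset.univ.filter (· ∈ H₂)) (fun x => by simp) : Nat.card H₂ = _)] at key

/-- **Conceded-subgroup cap in `S_n`.** With the tree's Vershik–Kerov theorem
(`VershikKerov1985_maxCharDegree_holds`, `ε := c₂/2`): for `n ≥ n₀`, every TPP triple of subsets
of `S_n` whose first set is (the underlying set of) a subgroup has
`|S|·|X₁|·|X₂| ≤ n!·d_max(S_n) ≤ (n!)^{3/2}·e^{-(c₂/2)√n}`.  In particular no such family witnesses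
`SnSubsetDichotomy.HyperoctahedralThreshold` for `c < c₂/2`: conceding a whole (rooted or full)
host, or any whole subgroup, is fatal for the crux. -/
theorem conceded_subgroup_cap :
    ∃ n₀ : ℕ, ∀ n ≥ n₀, ∀ (H : Subgroup (Equiv.Perm (Fin n))) (S X₁ X₂ : Finset (Equiv.Perm (Fin n))),
      (∀ x, x ∈ S ↔ x ∈ H) → TripleProductProperty S X₁ X₂ →
        ((S.card * X₁.card * X₂.card : ℕ) : ℝ) ≤
          (n.factorial : ℝ) ^ ((3 : ℝ) / 2) * Real.exp (-(vkUpperConst / 2 * Real.sqrt (n : ℝ))) := by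
  have hc := vkUpperConst_pos
  obtain ⟨n₀, hn₀⟩ := VershikKerov1985_maxCharDegree_holds (vkUpperConst / 2) (by linarith)
  refine ⟨n₀, fun n hn H S X₁ X₂ hS hT => ?_⟩
  classical
  have hnat := sieve H S X₁ X₂ hS hT
  rw [show Nat.card (Equiv.Perm (Fin n)) = n.factorial by
      rw [Nat.card_eq_fintype_card, Fintype.card_perm, Fintype.card_fin],
    (Nat.subtype_card S (fun x => hS x) : Nat.card H = S.card)] at hnat
  have hreal : ((S.card * X₁.card * X₂.card : ℕ) : ℝ) ≤
      (n.factorial : ℝ) * (maxCharDegree (Equiv.Perm (Fin n)) : ℝ) := by exact_mod_cast hnat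
  have hVK := (show vkUpperConst - vkUpperConst / 2 = vkUpperConst / 2 by ring) ▸ (hn₀ n hn).2
  have hF : (0 : ℝ) ≤ (n.factorial : ℝ) := Nat.cast_nonneg _
  have hpow : (n.factorial : ℝ) ^ ((3 : ℝ) / 2) = (n.factorial : ℝ) * Real.sqrt (n.factorial : ℝ) := by
    rw [show ((3 : ℝ) / 2) = 1 + (1 / 2 : ℝ) by norm_num, Real.rpow_add' hF (by norm_num),
      Real.rpow_one, Real.sqrt_eq_rpow]
  calc ((S.card * X₁.card * X₂.card : ℕ) : ℝ)
      ≤ (n.factorial : ℝ) * (maxCharDegree (Equiv.Perm (Fin n)) : ℝ) := hreal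
    _ ≤ (n.factorial : ℝ) * (Real.sqrt (n.factorial : ℝ) *
          Real.exp (-(vkUpperConst / 2 * Real.sqrt (n : ℝ)))) :=
        mul_le_mul_of_nonneg_left hVK hF
    _ = (n.factorial : ℝ) ^ ((3 : ℝ) / 2) * Real.exp (-(vkUpperConst / 2 * Real.sqrt (n : ℝ))) := by
        rw [hpow, mul_assoc]

end Summit.MatrixMultiplication.MatrixMultiplication.Theorems.HyperoctahedralThreshold.Negative
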